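import Summits.KontsevichZagierPeriods.Zeta5Search.TwoTaleOmega.StepGL
import Summits.KontsevichZagierPeriods.Zeta5Search.Certificates.TwoTaleTelescopeBgL

/-!
# (bmiss)@Ω — the recurrence in direction `bg`, FIRST TALE (cell `pub-zeta5`, fam-tele gen 5, on cert-1's `StepBL` template)

HONEST FRAMING: systematic search; recurrence certificates; no irrationality claim unless certified. Pure finite algebra
over `ℚ`; no named fact, no `sorry`. Nothing here is about the value of `ζ(2)` or `ζ(5)`.

Blueprint `families/tele/RECURRENCE.md` §13.10–13.12 / §14.10, direction `δ = bg = (0,1,0,0,1)` (the diagonal move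
`b ↦ b+1, g ↦ g+1`, which keeps `g − b` and `d(p)` fixed), side `L` (Zudilin's first tale), written on the pattern of
cert-1's pilot `TwoTaleOmega.StepBL` (direction `b`) and this family's `StepGL` (direction `g`).
INPUT: cert-2's telescoper of direction `bg` — the packed coefficient tables `cBg0..cBg3` and the certificate numerator
`xBgL = (g−b)(g−b+1)` of `Certificates.TwoTaleTelescopeBgL` (`Cert_L = t(t+a−e)(t+a−f)(t+g+2)·x_L/((t+g)(t+g+1)(t+g+2))`).
Instead of cert-2's cleared identity `telescope_bg_L` we use its REDUCED form (everything divided by the common value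
`W = F_L(p;t)/((t+g)(t+g+1)(t+g+2))`):
  `Z := c0·(t+g)(t+g+1)(t+g+2) + c1·(t+b)(t+g+1)(t+g+2) + c2·(t+b)(t+b+1)(t+g+2) + c3·(t+b)(t+b+1)(t+b+2)
        − x_L·[(t+a)(t+b)(t+e)(t+f) − t(t+a−e)(t+a−f)(t+g+2)] ≡ 0`,
a polynomial identity in `ℤ[a,b,e,f,g,t]` checked by `ring` from the CLOSED FORMS of the coefficients (`coefBG_zero …
coefBG_three`, decoded from the packed tables by `rfl`-style `simp`; exact re-verification `g5/bg/bg_decode.py`).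
OUTPUT (`recL_bg`): for a base point `p` with `p, p+δ, p+2δ, p+3δ ∈ Ω`,
  `Σ_{k<4} c^bg_k(p) · Λ¹_{node(p+kδ)}[vL(p+kδ)] = 0` and `Σ_{k<4} c^bg_k(p) · Λ⁰_{node(p+kδ)}[vL(p+kδ)] = 0`
(common truncation `D = d⁺ + 7`). Along `δ_bg` the ratio is `F_L(p+kδ;t)/F_L(p;t) = (t+b)_k/(t+g)_k`, the node
`1 − a₂*(e,f,b,a)` moves LEFT as `b` grows exactly as in direction `b` (crossed lattice points are double zeros,
`Pt.lam_vL_move`, `sq_lin_dvd_num`), and the telescoped function is `G = x_L · G_{g,L}`: the direction-`g` data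
`StepGL.NfGL / block(a, g+2)` scaled by the constant `x_L`. The leading coefficient is
`c^bg_3(p) = (a−g−2)(e−g−2)(f−g−2) < 0` on Ω (`coefBG_three`, `coefBG_three_neg`).
-/

noncomputable section

open Finset Polynomial
open Literature.NumberTheory.Irrationality.Zudilin2014
open Summit.KontsevichZagierPeriods.Zeta5Search.FormalBarnes
open Summit.KontsevichZagierPeriods.Zeta5Search.Certificates.TwoTaleTelescope

namespace Summit.KontsevichZagierPeriods.Zeta5Search.TwoTaleOmega

namespace Pt

variable (p : Pt)

/-! ### The diagonal move `δ_bg` -/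

/-- `p + k·δ_bg = (a, b+k, e, f, g+k)`. -/
def addBG (k : ℤ) : Pt := ⟨p.a, p.b + k, p.e, p.f, p.g + k⟩

/-- `a` is unchanged along `δ_bg`. -/
@[simp] theorem addBG_a (k : ℤ) : (p.addBG k).a = p.a := rfl
/-- `b` moves by `k` along `δ_bg`. -/
@[simp] theorem addBG_b (k : ℤ) : (p.addBG k).b = p.b + k := rfl
/-- `e` is unchanged along `δ_bg`. -/
@[simp] theorem addBG_e (k : ℤ) : (p.addBG k).e = p.e := rfl
/-- `f` is unchanged along `δ_bg`. -/
@[simp] theorem addBG_f (k : ℤ) : (p.addBG k).f = p.f := rfl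
/-- `g` moves by `k` along `δ_bg`. -/
@[simp] theorem addBG_g (k : ℤ) : (p.addBG k).g = p.g + k := rfl

/-- Zero step. -/
@[simp] theorem addBG_zero : p.addBG 0 = p := by cases p; simp [addBG]

/-- Steps along `δ_bg` add. -/
theorem addBG_addBG (k l : ℤ) : (p.addBG k).addBG l = p.addBG (k + l) := by
  simp only [addBG, Pt.mk.injEq]; refine ⟨trivial, by ring, trivial, trivial, by ring⟩

/-- `d(p)` is constant along `δ_bg`. -/
theorem dInt_addBG (k : ℤ) : (p.addBG k).dInt = p.dInt := by simp [dInt, addBG]; ring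

/-! ### The telescoper of direction `bg` at a point -/

/-- cert-2's telescoper coefficients `c^bg_0..c^bg_3` of direction `bg`, evaluated at `p` (packed data of
`Certificates.TwoTaleTelescopeBgL`). -/
def coefBG : Fin 4 → ℚ :=
  ![spvalC Certificates.TwoTaleTelescope.cBg0 (p.a : ℚ) p.b p.e p.f p.g, spvalC Certificates.TwoTaleTelescope.cBg1 (p.a : ℚ) p.b p.e p.f p.g,
    spvalC Certificates.TwoTaleTelescope.cBg2 (p.a : ℚ) p.b p.e p.f p.g, spvalC Certificates.TwoTaleTelescope.cBg3 (p.a : ℚ) p.b p.e p.f p.g]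

/-- The trailing coefficient in closed form: `c^bg_0(p) = b(b−a+e)(b−a+f)`. -/
theorem coefBG_zero : p.coefBG 0 = (p.b : ℚ) * (p.b - p.a + p.e) * (p.b - p.a + p.f) := by
  simp [coefBG, Certificates.TwoTaleTelescope.cBg0, spvalC, spvalN, spval, unpackT]; ring

/-- `c^bg_1(p)` in closed form (decoded from cert-2's packed table `cBg1`, 28 monomials). -/
theorem coefBG_one : p.coefBG 1 = -(p.a : ℚ) ^ 2 * p.b - p.a ^ 2 * p.g - p.a ^ 2 + p.a * p.b ^ 2 + 4 * p.a * p.b * p.g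
    + 4 * p.a * p.b + p.a * p.e * p.f + p.a * p.e * p.g + p.a * p.f * p.g + 2 * p.a * p.g + 3 * p.a + p.b ^ 2 * p.e
    + p.b ^ 2 * p.f - 3 * p.b ^ 2 * p.g - 3 * p.b ^ 2 - 2 * p.b * p.e * p.f - 2 * p.b * p.e * p.g + p.b * p.e
    - 2 * p.b * p.f * p.g + p.b * p.f - 3 * p.b * p.g - 5 * p.b - p.e * p.f * p.g - 2 * p.e * p.f - p.e * p.g - p.f * p.g
    - p.g - 2 := by
  simp [coefBG, Certificates.TwoTaleTelescope.cBg1, spvalC, spvalN, spval, unpackT]; ring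

/-- `c^bg_2(p)` in closed form (decoded from cert-2's packed table `cBg2`, 31 monomials). -/
theorem coefBG_two : p.coefBG 2 = (p.a : ℚ) ^ 2 * p.g + p.a ^ 2 + p.a * p.b * p.e + p.a * p.b * p.f - 2 * p.a * p.b * p.g
    - 3 * p.a * p.b - 2 * p.a * p.e * p.f + 2 * p.a * p.e + 2 * p.a * p.f - 2 * p.a * p.g ^ 2 - 7 * p.a * p.g - 7 * p.a
    + p.b * p.e * p.f - 2 * p.b * p.e * p.g - 3 * p.b * p.e - 2 * p.b * p.f * p.g - 3 * p.b * p.f + 3 * p.b * p.g ^ 2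
    + 9 * p.b * p.g + 7 * p.b + 2 * p.e * p.f * p.g + 4 * p.e * p.f + p.e * p.g ^ 2 - p.e * p.g - 4 * p.e + p.f * p.g ^ 2
    - p.f * p.g - 4 * p.f + 3 * p.g ^ 2 + 11 * p.g + 10 := by
  simp [coefBG, Certificates.TwoTaleTelescope.cBg2, spvalC, spvalN, spval, unpackT]; ring

/-- The leading coefficient in closed form: `c^bg_3(p) = (a−g−2)(e−g−2)(f−g−2)`. -/
theorem coefBG_three : p.coefBG 3 = ((p.a : ℚ) - p.g - 2) * (p.e - p.g - 2) * (p.f - p.g - 2) := by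
  simp [coefBG, Certificates.TwoTaleTelescope.cBg3, spvalC, spvalN, spval, unpackT]; ring

variable {p}
/-- On Ω the leading coefficient is negative (three factors `≤ −3`), in particular non-zero. -/
theorem coefBG_three_neg (h : p.Omega) : p.coefBG 3 < 0 := by
  rw [coefBG_three]
  obtain ⟨h1, h2, h3, h4, h5, h6, h7, h8, h9⟩ := h
  have ha : (3 : ℚ) ≤ (p.g : ℚ) + 2 - p.a := by exact_mod_cast (by omega : (3 : ℤ) ≤ p.g + 2 - p.a)
  have he : (3 : ℚ) ≤ (p.g : ℚ) + 2 - p.e := by exact_mod_cast (by omega : (3 : ℤ) ≤ p.g + 2 - p.e)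
  have hf : (3 : ℚ) ≤ (p.g : ℚ) + 2 - p.f := by exact_mod_cast (by omega : (3 : ℤ) ≤ p.g + 2 - p.f)
  have e1 : ((p.a : ℚ) - p.g - 2) * (p.e - p.g - 2) * (p.f - p.g - 2)
      = -(((p.g + 2 - p.a) * (p.g + 2 - p.e)) * (p.g + 2 - p.f)) := by ring
  rw [e1, neg_lt_zero]
  exact mul_pos (mul_pos (by linarith) (by linarith)) (by linarith)
/-- The leading coefficient `c^{bg}_3` is non-zero on `Ω`. -/
theorem coefBG_three_ne (h : p.Omega) : p.coefBG 3 ≠ 0 := (coefBG_three_neg h).ne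
/-- The certificate numerator `x_L` of direction `bg` is the `t`-free constant `(g−b)(g−b+1)`. -/
theorem xBgL_eval (s : ℤ) (a b e f g t : ℚ) : polyTN xBgL s a b e f g t = (g - b) * (g - b + 1) := by
  simp [polyTN, xBgL, spvalC, spvalN, spval, unpackT]; ring
variable (p)
/-- The value of `x_L` at `p`. -/
def xL : ℚ := ((p.g : ℚ) - p.b) * ((p.g : ℚ) - p.b + 1)
variable {p}
/-- `xL > 0` on `Ω`. -/
theorem xL_pos (h : p.Omega) : 0 < p.xL := by
  have := h.b3_le_g
  have h1 : (3 : ℚ) ≤ (p.g : ℚ) - p.b := by exact_mod_cast (by omega : (3 : ℤ) ≤ p.g - p.b)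
  unfold xL; exact mul_pos (by linarith) (by linarith)

/-! ### Block algebra along `δ_bg` -/
variable (p)
/-- Along `δ_bg` the numerator gains the block `(t+b)⋯(t+b+k−1)` (`k ≥ 0`, `p ∈ Ω`). -/
theorem num_addBG_eq (h : p.Omega) {k : ℤ} (hk : 0 ≤ k) :
    num (p.addBG k).t1a (p.addBG k).t1b = num p.t1a p.t1b * block p.b (p.b + k) := by
  have hb := h.b_ge; have := h.f_le
  rw [num_t1, num_t1]
  simp only [addBG_a, addBG_b, addBG_e, addBG_f]
  rw [← block_mul_block (lo := p.a - p.f + 1) (mi := p.b) (hi := p.b + k) (by omega) (by omega)]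
  ring
/-- Along `δ_bg` the denominator block grows: `den(p+kδ) = block(a, g+k)`. -/
theorem den_addBG_eq (k : ℤ) : den (p.addBG k).t1a (p.addBG k).t1b = block p.a (p.g + k) := by
  rw [den_t1]; simp only [addBG_a, addBG_g]

/-! ### The telescoped function `G = Cert_L · F_L(p;·) = x_L · G_{g,L}` as closed-form data -/
/-- **The telescoped data** `G_{bg,L}(p) = ofFrac [a,g+2) 1 (x_L · N_G)` with the direction-`g` numerator
`N_G = block(0,e)·block(a−e,f)·block(a−f,b)` (`StepGL.NfGL`). -/
def GfBGL : PF := PF.ofFrac (Ico p.a (p.g + 2)) (fun _ => 1) (C p.xL * p.NfGL)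
/-- The poles of `G_{bg,L}` lie in `[a,g+2)`. -/
theorem poles_GfBGL : p.GfBGL.poles ⊆ Ico p.a (p.g + 2) := PF.poles_ofFrac _ _ _
/-- Value of `G_{bg,L}`: `x_L · t(t+a−e)(t+a−f)·num(t)/block(a,g+2)(t)` off the poles. -/
theorem GfBGL_eval (h : p.Omega) {t : ℚ} (ht : ∀ k ∈ Ico p.a (p.g + 2), t + k ≠ 0) :
    p.GfBGL.eval t = p.xL * (t * (t + (p.a - p.e : ℤ)) * (t + (p.a - p.f : ℤ)))
      * ((num p.t1a p.t1b).eval t / (block p.a (p.g + 2)).eval t) := by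
  unfold GfBGL
  rw [PF.eval_ofFrac _ _ _ (fun _ _ => Or.inl rfl) ht, denom_Ico_one, NfGL_eq p h]
  simp only [eval_mul, eval_C, eval_lin]
  push_cast; ring
/-- Degree of the polynomial part of `G_{bg,L}`: `≤ d + 1 ≤ d⁺ + 7`. -/
theorem natDegree_GfBGL_le (h : p.Omega) : p.GfBGL.poly.natDegree ≤ dExp p.t1a p.t1b + 7 := by
  unfold GfBGL
  rw [PF.natDegree_ofFrac, sum_const, Int.card_Ico, smul_eq_mul, mul_one]
  have hN := natDegree_C_mul_le p.xL p.NfGL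
  rw [natDegree_NfGL p] at hN
  unfold dExp; rw [sum_t1a_sub_sum_t1b]; unfold dInt
  obtain ⟨h1, h2, h3, h4, h5, h6, h7, h8, h9⟩ := h
  omega

/-! ### Step (2): the function identity -/
/-- The exceptional set for Lemma U: the poles of both sides and of the shifted data (`[a−1, g+3]`) and the zeros of the
shift denominators. -/
def SbgL : Finset ℤ := Ico (p.a - 1) (p.g + 4) ∪ {1, p.a - p.e + 1, p.a - p.f + 1}
variable {p}

set_option maxHeartbeats 800000 in
/-- **Function identity** `Σ_k c^bg_k(p) F_L(p+kδ;t) = G(t+1) − G(t)` off the exceptional set. All four values and `G(t)` are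
polynomial multiples of `W = F_L(p;t)/((t+g)(t+g+1)(t+g+2))`, `G(t+1)` of `W' = F_L(p;t+1)/((t+g+1)(t+g+2)(t+g+3))`, and
`W`, `W'` are tied by the shift law of `F_L(p;·)` (`vL_shift`); what is left is the reduced identity `W·Z = 0`, `Z ≡ 0`
by `ring` on the closed forms of the coefficients. -/
theorem funId_bgL (h0 : p.Omega) (h1 : (p.addBG 1).Omega) (h2 : (p.addBG 2).Omega) (h3 : (p.addBG 3).Omega) {t : ℚ}
    (ht : ∀ k ∈ p.SbgL, t + k ≠ 0) :
    p.coefBG 0 * p.vL.eval t + p.coefBG 1 * (p.addBG 1).vL.eval t + p.coefBG 2 * (p.addBG 2).vL.eval t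
      + p.coefBG 3 * (p.addBG 3).vL.eval t = p.GfBGL.eval (t + 1) - p.GfBGL.eval t := by
  have o := h0
  obtain ⟨o1, o2, o3, o4, o5, o6, o7, o8, o9⟩ := h0
  -- non-vanishing off the exceptional set
  have hI : ∀ k : ℤ, p.a - 1 ≤ k → k < p.g + 4 → t + (k : ℚ) ≠ 0 := fun k hk1 hk2 =>
    ht k (by unfold SbgL; rw [mem_union]; left; rw [mem_Ico]; exact ⟨hk1, hk2⟩)
  have hlin : ∀ c : ℚ, ∀ k : ℤ, p.a - 1 ≤ k → k < p.g + 4 → c = t + (k : ℚ) → c ≠ 0 :=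
    fun c k hk1 hk2 hc => by rw [hc]; exact hI k hk1 hk2
  have hS0 : ∀ k ∈ Ico p.a p.g, t + (k : ℚ) ≠ 0 := fun k hk => by
    rw [mem_Ico] at hk; exact hI k (by omega) (by omega)
  have hS0' : ∀ k ∈ Ico p.a p.g, t + 1 + (k : ℚ) ≠ 0 := fun k hk => by
    rw [mem_Ico] at hk
    have := hI (k + 1) (by omega) (by omega)
    push_cast at this
    rwa [add_assoc, add_comm (1:ℚ)]
  have hS1 : ∀ k ∈ Ico (p.addBG 1).a (p.addBG 1).g, t + (k : ℚ) ≠ 0 := fun k hk => by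
    simp only [addBG_a, addBG_g, mem_Ico] at hk; exact hI k (by omega) (by omega)
  have hS2 : ∀ k ∈ Ico (p.addBG 2).a (p.addBG 2).g, t + (k : ℚ) ≠ 0 := fun k hk => by
    simp only [addBG_a, addBG_g, mem_Ico] at hk; exact hI k (by omega) (by omega)
  have hS3 : ∀ k ∈ Ico (p.addBG 3).a (p.addBG 3).g, t + (k : ℚ) ≠ 0 := fun k hk => by
    simp only [addBG_a, addBG_g, mem_Ico] at hk; exact hI k (by omega) (by omega)
  have hG2 : ∀ k ∈ Ico p.a (p.g + 2), t + (k : ℚ) ≠ 0 := fun k hk => by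
    rw [mem_Ico] at hk; exact hI k (by omega) (by omega)
  have hG2' : ∀ k ∈ Ico p.a (p.g + 2), t + 1 + (k : ℚ) ≠ 0 := fun k hk => by
    rw [mem_Ico] at hk
    have := hI (k + 1) (by omega) (by omega)
    push_cast at this
    rwa [add_assoc, add_comm (1:ℚ)]
  have hg0 : t + p.g ≠ 0 := hlin _ p.g (by omega) (by omega) (by norm_num)
  have hg1 : t + p.g + 1 ≠ 0 := hlin _ (p.g + 1) (by omega) (by omega) (by push_cast; ring)
  have hg2 : t + p.g + 2 ≠ 0 := hlin _ (p.g + 2) (by omega) (by omega) (by push_cast; ring)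
  have hg3 : t + p.g + 3 ≠ 0 := hlin _ (p.g + 3) (by omega) (by omega) (by push_cast; ring)
  have hD0 : (block p.a p.g).eval t ≠ 0 := eval_block_ne_zero fun i hi h => hS0 i hi (by rw [h]; ring)
  have hD0' : (block p.a p.g).eval (t + 1) ≠ 0 := eval_block_ne_zero fun i hi h => hS0' i hi (by rw [h]; ring)
  have hP3 : (t + p.g) * (t + p.g + 1) * (t + p.g + 2) ≠ 0 := mul_ne_zero (mul_ne_zero hg0 hg1) hg2
  have hP3' : (t + p.g + 1) * (t + p.g + 2) * (t + p.g + 3) ≠ 0 := mul_ne_zero (mul_ne_zero hg1 hg2) hg3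
  -- the blocks along δ_bg
  have e123 := eval_block_123 p.g t
  have f123 := eval_block_123 p.b t
  have hb1 : (block p.a (p.g + 1)).eval t = (block p.a p.g).eval t * (t + p.g) := by
    rw [block_addG p o (k := 1) (by norm_num), eval_mul, e123.1]
  have hb2 : (block p.a (p.g + 2)).eval t = (block p.a p.g).eval t * ((t + p.g) * (t + p.g + 1)) := by
    rw [block_addG p o (k := 2) (by norm_num), eval_mul, e123.2.1]
  have hb3 : (block p.a (p.g + 3)).eval t = (block p.a p.g).eval t * ((t + p.g) * (t + p.g + 1) * (t + p.g + 2)) := by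
    rw [block_addG p o (k := 3) (by norm_num), eval_mul, e123.2.2]
  have hb2' : (block p.a (p.g + 2)).eval (t + 1) = (block p.a p.g).eval (t + 1) * ((t + 1 + p.g) * (t + 1 + p.g + 1)) := by
    rw [block_addG p o (k := 2) (by norm_num), eval_mul, (eval_block_123 p.g (t + 1)).2.1]
  -- the base values W = F_L(p;t)/((t+g)(t+g+1)(t+g+2)), W' = F_L(p;t+1)/((t+g+1)(t+g+2)(t+g+3))
  set W := p.vL.eval t / ((t + p.g) * (t + p.g + 1) * (t + p.g + 2)) with hW
  set W' := p.vL.eval (t + 1) / ((t + p.g + 1) * (t + p.g + 2) * (t + p.g + 3)) with hW'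
  have eF0 : p.vL.eval t = W * ((t + p.g) * (t + p.g + 1) * (t + p.g + 2)) := by
    rw [hW, div_mul_cancel₀ _ hP3]
  have eF0' : p.vL.eval (t + 1) = W' * ((t + p.g + 1) * (t + p.g + 2) * (t + p.g + 3)) := by
    rw [hW', div_mul_cancel₀ _ hP3']
  have eN : (num p.t1a p.t1b).eval t = W * ((block p.a p.g).eval t * ((t + p.g) * (t + p.g + 1) * (t + p.g + 2))) := by
    have := vL_eval_w o hS0
    rw [den_t1] at this
    rw [← (eq_div_iff hD0).1 this, eF0]; ring
  have eF1 : (p.addBG 1).vL.eval t = W * ((t + p.b) * ((t + p.g + 1) * (t + p.g + 2))) := by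
    rw [vL_eval_w h1 hS1, num_addBG_eq p o (k := 1) (by norm_num), den_addBG_eq, eval_mul, f123.1, hb1, eN,
      div_eq_iff (mul_ne_zero hD0 hg0)]
    ring
  have eF2 : (p.addBG 2).vL.eval t = W * ((t + p.b) * (t + p.b + 1) * (t + p.g + 2)) := by
    rw [vL_eval_w h2 hS2, num_addBG_eq p o (k := 2) (by norm_num), den_addBG_eq, eval_mul, f123.2.1, hb2, eN,
      div_eq_iff (mul_ne_zero hD0 (mul_ne_zero hg0 hg1))]
    ring
  have eF3 : (p.addBG 3).vL.eval t = W * ((t + p.b) * (t + p.b + 1) * (t + p.b + 2)) := by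
    rw [vL_eval_w h3 hS3, num_addBG_eq p o (k := 3) (by norm_num), den_addBG_eq, eval_mul, f123.2.2, hb3, eN,
      div_eq_iff (mul_ne_zero hD0 hP3)]
    ring
  have eG0 : p.GfBGL.eval t = p.xL * (t * (t + (p.a - p.e : ℤ)) * (t + (p.a - p.f : ℤ)) * (t + p.g + 2)) * W := by
    have q0 : W * ((block p.a p.g).eval t * ((t + p.g) * (t + p.g + 1) * (t + p.g + 2)))
        / ((block p.a p.g).eval t * ((t + p.g) * (t + p.g + 1))) = W * (t + p.g + 2) := by
      rw [div_eq_iff (mul_ne_zero hD0 (mul_ne_zero hg0 hg1))]; ring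
    rw [GfBGL_eval p o hG2, hb2, eN, q0]; ring
  have eG1 : p.GfBGL.eval (t + 1)
      = p.xL * ((t + 1) * (t + 1 + (p.a - p.e : ℤ)) * (t + 1 + (p.a - p.f : ℤ)) * (t + p.g + 3)) * W' := by
    have eN' : (num p.t1a p.t1b).eval (t + 1)
        = W' * ((block p.a p.g).eval (t + 1) * ((t + p.g + 1) * (t + p.g + 2) * (t + p.g + 3))) := by
      have := vL_eval_w o hS0'
      rw [den_t1] at this
      rw [← (eq_div_iff hD0').1 this, eF0']; ring
    have hq : (t + 1 + p.g) * (t + 1 + p.g + 1) ≠ 0 :=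
      mul_ne_zero (by rw [show t + 1 + (p.g : ℚ) = t + p.g + 1 by ring]; exact hg1)
        (by rw [show t + 1 + (p.g : ℚ) + 1 = t + p.g + 2 by ring]; exact hg2)
    have q1 : W' * ((block p.a p.g).eval (t + 1) * ((t + p.g + 1) * (t + p.g + 2) * (t + p.g + 3)))
        / ((block p.a p.g).eval (t + 1) * ((t + 1 + p.g) * (t + 1 + p.g + 1))) = W' * (t + p.g + 3) := by
      rw [div_eq_iff (mul_ne_zero hD0' hq)]; ring
    rw [GfBGL_eval p o hG2', hb2', eN', q1]; ring
  -- the shift law of F_L(p;·), in terms of W and W'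
  have hshift := vL_shift o hS0 hS0'
  have hshiftW : W' * ((t + 1) * (t + (p.a - p.e + 1 : ℤ)) * (t + (p.a - p.f + 1 : ℤ)) * (t + p.g + 3))
      = W * ((t + p.e) * (t + p.f) * (t + p.b) * (t + p.a)) := by
    apply mul_right_cancel₀ hP3
    rw [eF0, eF0'] at hshift
    linear_combination hshift
  push_cast at hshiftW
  -- the reduced telescoping identity `Z ≡ 0` (module docstring) is checked by `ring` from the closed forms of `c^bg_k`
  rw [coefBG_zero, coefBG_one, coefBG_two, coefBG_three, eF0, eF1, eF2, eF3, eG0, eG1]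
  unfold xL
  push_cast
  linear_combination (-(((p.g : ℚ) - p.b) * ((p.g : ℚ) - p.b + 1))) * hshiftW

/-! ### Step (3): the DATA identity -/
/-- **Data identity** `Σ_k c^bg_k(p)·vL(p+kδ) = S G − G` (Lemma U over the exceptional set `SbgL`). -/
theorem dataId_bgL (h0 : p.Omega) (h1 : (p.addBG 1).Omega) (h2 : (p.addBG 2).Omega) (h3 : (p.addBG 3).Omega) :
    PF.comb4 p.coefBG ![p.vL, (p.addBG 1).vL, (p.addBG 2).vL, (p.addBG 3).vL]
      = p.GfBGL.shift.add (p.GfBGL.smul (-1)) := by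
  have hIco : Ico p.a (p.g + 2) ⊆ p.SbgL := fun k hk => by
    unfold SbgL; rw [mem_union]; left; rw [mem_Ico] at hk ⊢; omega
  have hvk : ∀ q : Pt, q.a = p.a → q.g ≤ p.g + 3 → q.vL.poles ⊆ p.SbgL := fun q hqa hqg => by
    refine (poles_vL q).trans fun j hj => ?_
    rw [mem_Ico, amax_t1a_eq] at hj
    unfold SbgL; rw [mem_union]; left; rw [mem_Ico]; omega
  refine PF.eq_of_eval_eq_on _ _ p.SbgL ?_ ?_ fun t ht => ?_
  · refine (PF.poles_comb4_subset _ _).trans (union_subset (union_subset ?_ ?_) (union_subset ?_ ?_)) <;>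
      simp only [Matrix.cons_val_zero, Matrix.cons_val_one, Matrix.cons_val_two, Matrix.cons_val_three,
        Matrix.head_cons, Matrix.tail_cons]
    · exact hvk p rfl (by omega)
    · exact hvk _ rfl (by simp)
    · exact hvk _ rfl (by simp)
    · exact hvk _ rfl (by simp)
  · refine (PF.poles_shift_sub_subset _).trans (union_subset ?_ ((poles_GfBGL p).trans hIco))
    intro k hk
    obtain ⟨j, hj, rfl⟩ := mem_image.1 hk
    have hj' := poles_GfBGL p hj
    unfold SbgL; rw [mem_union]; left; rw [mem_Ico] at hj' ⊢; omega
  · rw [PF.eval_comb4, PF.eval_shift_sub, Fin.sum_univ_four]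
    simp only [Matrix.cons_val_zero, Matrix.cons_val_one, Matrix.cons_val_two, Matrix.cons_val_three,
      Matrix.head_cons, Matrix.tail_cons]
    exact funId_bgL h0 h1 h2 h3 ht

/-! ### Step (4): legitimacy at the common node `s* = node(p)` -/
/-- The common node is not a pole and `x_L·N_G` has a double zero there: `ρ⁰_{s*}(G) = ρ¹_{s*}(G) = 0`. -/
theorem GfBGL_rho (h : p.Omega) : rho0 p.nodeL p.GfBGL = 0 ∧ rho1 p.nodeL p.GfBGL = 0 := by
  have sp := a2star_t1a_eq h
  obtain ⟨o1, o2, o3, o4, o5, o6, o7, o8, o9⟩ := h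
  set m := a2star p.t1a with hm
  have hnode : p.nodeL = -(m - 1) := by unfold nodeL; ring
  have hc : m - 1 ∉ Ico p.a (p.g + 2) := by rw [mem_Ico]; omega
  rw [hnode]
  refine ⟨PF.rho0_ofFrac_eq_zero _ _ _ (fun _ _ => Or.inl rfl) hc ?_, PF.rho1_ofFrac_eq_zero _ _ _ hc⟩
  -- double zero of `N_G = block(0,e)·block(a−e,f)·block(a−f,b)` at `t = 1 − m`
  refine Dvd.dvd.mul_left ?_ _
  have hcases : (0 ≤ m - 1 ∧ m - 1 < p.e ∧ p.a - p.e ≤ m - 1 ∧ m - 1 < p.f)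
      ∨ (0 ≤ m - 1 ∧ m - 1 < p.e ∧ p.a - p.f ≤ m - 1 ∧ m - 1 < p.b)
      ∨ (p.a - p.e ≤ m - 1 ∧ m - 1 < p.f ∧ p.a - p.f ≤ m - 1 ∧ m - 1 < p.b) := by omega
  unfold NfGL
  rcases hcases with ⟨a1, a2, a3, a4⟩ | ⟨a1, a2, a3, a4⟩ | ⟨a1, a2, a3, a4⟩
  · exact (pow_two (lin (m - 1)) ▸ mul_dvd_mul (lin_dvd_block a1 a2) (lin_dvd_block a3 a4)).mul_right _
  · refine (pow_two (lin (m - 1)) ▸ mul_dvd_mul (lin_dvd_block a1 a2) (lin_dvd_block a3 a4)).trans ?_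
    exact ⟨block (p.a - p.e) p.f, by ring⟩
  · refine (pow_two (lin (m - 1)) ▸ mul_dvd_mul (lin_dvd_block a1 a2) (lin_dvd_block a3 a4)).trans ?_
    exact ⟨block 0 p.e, by ring⟩

/-! ### Step (5): node moves (as in direction `b`) -/
/-- Along `δ_bg` (`k ≥ 0`) the own node of `p+kδ` lies left of the common node `s* = node(p)`, and `F_L(p+kδ;·)` has a
double zero at every lattice point in between: `Λ_{node(p+kδ)}[vL(p+kδ)] = Λ_{s*}[vL(p+kδ)]` in both coordinates. -/
theorem lam_nodes_bgL (h0 : p.Omega) {k : ℤ} (hk0 : 0 ≤ k) (hk : (p.addBG k).Omega) (D : ℕ)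
    (hD : (p.addBG k).vL.poly.natDegree ≤ D) :
    lam0 D (p.addBG k).nodeL (p.addBG k).vL = lam0 D p.nodeL (p.addBG k).vL ∧
      lam1 (p.addBG k).nodeL (p.addBG k).vL = lam1 p.nodeL (p.addBG k).vL := by
  have sp := a2star_t1a_eq h0
  have spk := a2star_t1a_eq hk
  simp only [addBG_b, addBG_e, addBG_f] at spk
  obtain ⟨o1, o2, o3, o4, o5, o6, o7, o8, o9⟩ := h0
  have hle : a2star p.t1a ≤ a2star (p.addBG k).t1a := by rw [sp, spk]; omega
  have hlo : p.a - max p.e p.f + 1 ≤ a2star p.t1a := by rw [sp]; omega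
  obtain ⟨n, hn⟩ : ∃ n : ℕ, a2star (p.addBG k).t1a = a2star p.t1a + n :=
    ⟨(a2star (p.addBG k).t1a - a2star p.t1a).toNat, by rw [Int.toNat_of_nonneg (sub_nonneg.2 hle)]; ring⟩
  have hs : p.nodeL = (p.addBG k).nodeL + n := by unfold nodeL; rw [hn]; ring
  rw [hs]
  have ha : -(p.addBG k).nodeL < (p.addBG k).a := by simp only [addBG_a]; unfold nodeL; omega
  refine (lam_vL_move hk _ n D hD ha fun i hi => ?_).imp Eq.symm Eq.symm
  refine sq_lin_dvd_num hk ?_ ?_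
  · simp only [addBG_a, addBG_e, addBG_f]; unfold nodeL; omega
  · unfold nodeL; omega

/-! ### Step (6): the first-tale recurrence of direction `bg` -/
/-- **Direction `bg`, first tale.** For `p, p+δ, p+2δ, p+3δ ∈ Ω` (`δ = δ_bg`), the first-tale functionals at their own
nodes satisfy cert-2's telescoper: `Σ_k c^bg_k(p)·Λ¹_{node(p+kδ)}[vL(p+kδ)] = 0` and the same for `Λ⁰` with the common
truncation `D = d⁺(p) + 7`. -/
theorem recL_bg (h0 : p.Omega) (h1 : (p.addBG 1).Omega) (h2 : (p.addBG 2).Omega) (h3 : (p.addBG 3).Omega) :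
    (p.coefBG 0 * lam1 p.nodeL p.vL + p.coefBG 1 * lam1 (p.addBG 1).nodeL (p.addBG 1).vL
      + p.coefBG 2 * lam1 (p.addBG 2).nodeL (p.addBG 2).vL + p.coefBG 3 * lam1 (p.addBG 3).nodeL (p.addBG 3).vL = 0) ∧
    (p.coefBG 0 * lam0 (dExp p.t1a p.t1b + 7) p.nodeL p.vL
      + p.coefBG 1 * lam0 (dExp p.t1a p.t1b + 7) (p.addBG 1).nodeL (p.addBG 1).vL
      + p.coefBG 2 * lam0 (dExp p.t1a p.t1b + 7) (p.addBG 2).nodeL (p.addBG 2).vL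
      + p.coefBG 3 * lam0 (dExp p.t1a p.t1b + 7) (p.addBG 3).nodeL (p.addBG 3).vL = 0) := by
  set D := dExp p.t1a p.t1b + 7 with hDdef
  have hdata := dataId_bgL h0 h1 h2 h3
  have hrho := GfBGL_rho h0
  -- degrees (d is constant along δ_bg)
  have hDk : ∀ q : Pt, q.Omega → q.a = p.a → q.e = p.e → q.f = p.f → q.g - q.b = p.g - p.b →
      q.vL.poly.natDegree ≤ D := fun q hq qa qe qf qgb => by
    refine (vL_natDegree_le_w hq).trans ?_
    rw [hDdef]; unfold dExp; rw [sum_t1a_sub_sum_t1b, sum_t1a_sub_sum_t1b]; unfold dInt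
    rw [qa, qe, qf]; omega
  have hD1 := hDk _ h1 rfl rfl rfl (by simp)
  have hD2 := hDk _ h2 rfl rfl rfl (by simp)
  have hD3 := hDk _ h3 rfl rfl rfl (by simp)
  have m1 := lam_nodes_bgL h0 (by norm_num) h1 D hD1
  have m2 := lam_nodes_bgL h0 (by norm_num) h2 D hD2
  have m3 := lam_nodes_bgL h0 (by norm_num) h3 D hD3
  have s1 := lam1_step p.nodeL p.coefBG _ p.GfBGL hdata
  have s0 := lam0_step D p.nodeL p.coefBG _ p.GfBGL hdata (natDegree_GfBGL_le p h0)
  rw [Fin.sum_univ_four] at s1 s0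
  simp only [Matrix.cons_val_zero, Matrix.cons_val_one, Matrix.cons_val_two, Matrix.cons_val_three,
    Matrix.head_cons, Matrix.tail_cons] at s1 s0
  rw [hrho.2] at s1
  rw [hrho.1] at s0
  rw [m1.2, m2.2, m3.2, m1.1, m2.1, m3.1]
  exact ⟨s1, s0⟩

end Pt

end Summit.KontsevichZagierPeriods.Zeta5Search.TwoTaleOmega

end
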